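import Mathlib
import Literature.Analysis.FluidPDE.TypeIICoreWitness
import Literature.Analysis.FluidPDE.LerayHopf
import Literature.Analysis.FluidPDE.ClassicalSolutionRescale
import Literature.Analysis.FluidPDE.ClassicalSolutionGlue
import Literature.Analysis.FluidPDE.IsometryInvariance
import Literature.Barriers.NavierStokesRegularity.SupNormCalderonZygmundWitnesses
import Summits.NavierStokesRegularity.NavierStokesRegularity.Theorems.TypeIIInviscidRelaxationMonopoleCoreExclusionAzimuthalAverage
import Summits.NavierStokesRegularity.NavierStokesRegularity.Theorems.TypeIIInviscidRelaxationMonopoleCoreExclusionAxisymCutoff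
import Summits.NavierStokesRegularity.NavierStokesRegularity.Theorems.TypeIIInviscidRelaxationColumnarCoreExclusionDivFreeDatum
import HarnessLib

/-!
# Crux `MonopoleCoreExclusion` (stmt-NavierStokesRegularity-1965), line `axisymmetric_comparison_flow`:
# the transfer stub `stub_axisymComparisonFlowOfAX` in CORRECTED form — from the STRONG (symmetric, slab-bounded)
# form of axisymmetric global regularity

`--supports stmt-NavierStokesRegularity-1965` (helper file; theorems only, no definitions, no `sorry`).

The registered transfer stub takes `AxisymSwirlRegular` in its Clay-(A) form (`∃` a global classical solution with bounded
energy).  As diagnosed by hands 4-g0 / 6-g0 / 6-g1, that output carries neither the axisymmetry of the continuation nor its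
boundedness on compact time slabs, and the tree's uniqueness / symmetry-propagation theorems (`IsClassicalNSSolutionOn.unique`,
`isAxisymmetric_of_data_holds`) need `HasUniformRapidDecayOn`, which Clay-(A) does not supply.  This file proves the stub's
conclusion VERBATIM (universal constant `A = 2`, closeness on the core ball `ball x₀ (KL)`) from the STRONG form of the
conjecture — global classical solutions from smooth, divergence-free, rapidly decaying axisymmetric data which STAY
axisymmetric and are bounded on every slab `[0,T'] × ℝ³` (this is what the no-blow-up hypothesis `hNB` of the tree's
`axisymSwirlRegular_of_noBlowup` produces) — by the chain
  azimuthal-average datum (`AzimuthalComparisonDatum.exists_smooth_axisym_azimuthalAverage_close_ball`, p826992, `2V/K`)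
  → axisymmetric divergence-free compactly supported cut-off (`AxisymDivFreeCutoff.exists_axisym_divFree_cutoff`, p830019)
  → rapid decay (`hasRapidSpatialDecay_of_hasCompactSupport`) → strong AX at the frame datum
  → time shift (`comp_add_right`), rotation (`conj_linearIsometryEquiv Q`), translation (`spaceTranslate`).
HONEST FRAMING: a kernel form of the corrected stub; the registered signature (Clay-(A) hypothesis) is NOT closed, the crux
and everything above it are untouched; nothing about Navier–Stokes regularity is claimed.
-/

noncomputable section

open Set Metric MeasureTheory Function
open Literature.Analysis Literature.Analysis.FluidPDE
open scoped InnerProductSpace ContDiff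

namespace Summit.NavierStokesRegularity.NavierStokesRegularity.Theorems

-- the problem directory repeats the summit name (`NavierStokesRegularity/NavierStokesRegularity`)
set_option linter.dupNamespace false

namespace AxisymComparisonFlow

open ColumnarComparisonDatum (isDivFree_comp_add)
open AzimuthalComparisonDatum (exists_smooth_axisym_azimuthalAverage_close_ball)
open AxisymDivFreeCutoff (exists_axisym_divFree_cutoff)
open Literature.Barriers.NavierStokesRegularity.SupNormCZ (hasRapidSpatialDecay_of_hasCompactSupport)

/-- **The axisymmetric comparison flow from a frame datum, given the STRONG form of axisymmetric global regularity.**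
Let `g : ℝ³ → ℝ³` be smooth, divergence free and axisymmetric, `ρ > 0`, `ν > 0`, `t < T`, `x₀ ∈ ℝ³`, `Q` a linear
isometry.  If smooth divergence-free rapidly decaying axisymmetric data launch global classical solutions that stay
axisymmetric and are bounded on compact time slabs, then there is a classical solution `(v, q)` of the unforced system
on `[t, T] × ℝ³`, axisymmetric about the witness axis (`y ↦ Q⁻¹ v(s, x₀ + Q y)` is `IsAxisymmetric` for every `s`),
bounded on `[t, T] × ℝ³`, with `v t x = Q (g (Q⁻¹(x − x₀)))` whenever `‖Q⁻¹(x − x₀)‖ < ρ` (cut `g` off between `ρ`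
and `2ρ`, launch, shift, rotate, translate). [folklore] -/
theorem exists_axisym_flow_of_frame_datum
    (hAXs : ∀ ν : ℝ, 0 < ν → ∀ u₀ : EuclideanSpace ℝ (Fin 3) → EuclideanSpace ℝ (Fin 3),
      ContDiff ℝ ∞ u₀ → VectorCalculus.IsDivFree u₀ → HasRapidSpatialDecay u₀ → IsAxisymmetric u₀ →
      ∃ (u : ℝ → EuclideanSpace ℝ (Fin 3) → EuclideanSpace ℝ (Fin 3)) (p : ℝ → EuclideanSpace ℝ (Fin 3) → ℝ),
        IsClassicalNSSolutionOn (Ici 0) ν 0 u p ∧ u 0 = u₀ ∧ (∀ s : ℝ, 0 ≤ s → IsAxisymmetric (u s)) ∧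
        ∀ T' : ℝ, ∃ M : ℝ, ∀ s ∈ Icc 0 T', ∀ x, ‖u s x‖ ≤ M)
    {g : EuclideanSpace ℝ (Fin 3) → EuclideanSpace ℝ (Fin 3)}
    (hg : ContDiff ℝ ∞ g) (hdiv : VectorCalculus.IsDivFree g) (hax : IsAxisymmetric g) {ρ : ℝ} (hρ : 0 < ρ)
    {ν t T : ℝ} (hν : 0 < ν) (htT : t < T) (x₀ : EuclideanSpace ℝ (Fin 3))
    (Q : EuclideanSpace ℝ (Fin 3) ≃ₗᵢ[ℝ] EuclideanSpace ℝ (Fin 3)) :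
    ∃ (v : ℝ → EuclideanSpace ℝ (Fin 3) → EuclideanSpace ℝ (Fin 3))
      (q : ℝ → EuclideanSpace ℝ (Fin 3) → ℝ) (Mv : ℝ),
      IsClassicalNSSolutionOn (Icc t T) ν 0 v q ∧
      (∀ s ∈ Icc t T, IsAxisymmetric (fun y : EuclideanSpace ℝ (Fin 3) => Q.symm (v s (x₀ + Q y)))) ∧
      (∀ s ∈ Icc t T, ∀ x, ‖v s x‖ ≤ Mv) ∧
      (∀ x : EuclideanSpace ℝ (Fin 3), ‖Q.symm (x - x₀)‖ < ρ → v t x = Q (g (Q.symm (x - x₀)))) := by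
  -- cut-off between `ρ` and `2ρ`, rapid decay, launch
  obtain ⟨gc, hgcs, hgcdiv, hgcax, hgc_eq, -, hgc_cpt⟩ :=
    exists_axisym_divFree_cutoff hg hdiv hax hρ (by linarith : ρ < 2 * ρ)
  have hdec : HasRapidSpatialDecay gc := hasRapidSpatialDecay_of_hasCompactSupport hgcs hgc_cpt
  obtain ⟨U, P, hU, hU0, hUax, hUbd⟩ := hAXs ν hν gc hgcs hgcdiv hdec hgcax
  obtain ⟨M, hM⟩ := hUbd (T - t)
  -- time shift by `-t`, restrict to `[t, T]`, rotate by `Q`, translate to `x₀`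
  have h1 := hU.comp_add_right (-t)
  have hsub : Icc t T ⊆ (· + -t) ⁻¹' Ici (0 : ℝ) := fun s hs => by
    show s + -t ∈ Ici (0 : ℝ)
    simp only [mem_Ici]; linarith [hs.1]
  have h2 := h1.mono hsub (uniqueDiffOn_Icc htT)
  have h3 := h2.conj_linearIsometryEquiv (R := Q) (uniqueDiffOn_Icc htT)
  have h4 := h3.spaceTranslate (-x₀)
  refine ⟨_, _, M, h4.congr_force fun s _ x => by simp, ?_, ?_, ?_⟩
  · -- axisymmetric about the witness axis, at every time
    intro s hs θ y
    show Q.symm (Q (U (s + -t) (Q.symm (-x₀ + (x₀ + Q (rotZ θ y)))))) =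
      rotZ θ (Q.symm (Q (U (s + -t) (Q.symm (-x₀ + (x₀ + Q y))))))
    simp only [LinearIsometryEquiv.symm_apply_apply, neg_add_cancel_left]
    exact hUax _ (by linarith [hs.1]) θ y
  · -- bounded on `[t, T]`
    intro s hs x
    show ‖Q (U (s + -t) (Q.symm (-x₀ + x)))‖ ≤ M
    rw [LinearIsometryEquiv.norm_map]
    exact hM _ ⟨by linarith [hs.1], by linarith [hs.2]⟩ _
  · -- the initial slice on `‖Y‖ < ρ`
    intro x hx
    show Q (U (t + -t) (Q.symm (-x₀ + x))) = Q (g (Q.symm (x - x₀)))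
    rw [add_neg_cancel, hU0, show -x₀ + x = x - x₀ by abel,
      hgc_eq _ (by rwa [mem_ball, dist_zero_right])]

/-- **The transfer stub of the line in corrected form** (`stub_axisymComparisonFlowOfAX` with its hypothesis replaced by the
STRONG form of axisymmetric global regularity — the continuation stays axisymmetric and is bounded on compact time slabs;
all other binders and the conclusion verbatim, universal constant `A = 2`): from a level-`K ≥ 1` axisymmetric core datum
at time `t` of a classical solution `u`, an EXACTLY AXISYMMETRIC (about the witness axis) classical Navier–Stokes solution
`v` on `[t, T]`, bounded, `2V/K`-close to `u(t)` on the core ball `ball x₀ (KL)`.  Chain: azimuthal-average datum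
(p826992) → axisymmetric divergence-free compactly supported cut-off (p830019) → strong AX → shift / rotate / translate.
The Leray–Hopf, decay, `0 < t` and Reynolds-number hypotheses are not used. [folklore] -/
theorem axisymComparisonFlow_of_strongAX
    (hAXs : ∀ ν : ℝ, 0 < ν → ∀ u₀ : EuclideanSpace ℝ (Fin 3) → EuclideanSpace ℝ (Fin 3),
      ContDiff ℝ ∞ u₀ → VectorCalculus.IsDivFree u₀ → HasRapidSpatialDecay u₀ → IsAxisymmetric u₀ →
      ∃ (u : ℝ → EuclideanSpace ℝ (Fin 3) → EuclideanSpace ℝ (Fin 3)) (p : ℝ → EuclideanSpace ℝ (Fin 3) → ℝ),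
        IsClassicalNSSolutionOn (Ici 0) ν 0 u p ∧ u 0 = u₀ ∧ (∀ s : ℝ, 0 ≤ s → IsAxisymmetric (u s)) ∧
        ∀ T' : ℝ, ∃ M : ℝ, ∀ s ∈ Icc 0 T', ∀ x, ‖u s x‖ ≤ M) :
    ∃ A : ℝ, 0 < A ∧
      ∀ (ν T t K : ℝ) (u : ℝ → EuclideanSpace ℝ (Fin 3) → EuclideanSpace ℝ (Fin 3))
        (p : ℝ → EuclideanSpace ℝ (Fin 3) → ℝ),
        0 < ν → 0 < T → IsClassicalNSSolutionOn (Ico 0 T) ν 0 u p → IsLerayHopfOn T ν 0 (u 0) u →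
        HasRapidSpatialDecay (u 0) → 0 < t → t < T → 1 ≤ K →
        ∀ (x₀ : EuclideanSpace ℝ (Fin 3)) (L V : ℝ)
          (Q : EuclideanSpace ℝ (Fin 3) ≃ₗᵢ[ℝ] EuclideanSpace ℝ (Fin 3))
          (W : EuclideanSpace ℝ (Fin 3) → EuclideanSpace ℝ (Fin 3)),
          0 < L → 0 < V → IsAxisymmetric W → (∀ x, ‖u t x‖ ≤ V) → K * ν ≤ L * V →
          (∀ y : EuclideanSpace ℝ (Fin 3), ‖y‖ ≤ K →
            ‖V⁻¹ • Q.symm (u t (x₀ + L • Q y)) - W y‖ ≤ K⁻¹) →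
          ∃ (v : ℝ → EuclideanSpace ℝ (Fin 3) → EuclideanSpace ℝ (Fin 3))
            (q : ℝ → EuclideanSpace ℝ (Fin 3) → ℝ) (Mv : ℝ),
            IsClassicalNSSolutionOn (Icc t T) ν 0 v q ∧
            (∀ s ∈ Icc t T, IsAxisymmetric (fun y : EuclideanSpace ℝ (Fin 3) => Q.symm (v s (x₀ + Q y)))) ∧
            (∀ s ∈ Icc t T, ∀ x, ‖v s x‖ ≤ Mv) ∧
            (∀ x ∈ ball x₀ (K * L), ‖u t x - v t x‖ ≤ A * V / K) := by
  refine ⟨2, by norm_num, ?_⟩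
  intro ν T t K u p hν _hT hns _hLH _hdec ht htT hK x₀ L V Q W hL hV hW hbd _hRe hclose
  have hK0 : 0 < K := lt_of_lt_of_le one_pos hK
  have hKL : 0 < K * L := mul_pos hK0 hL
  have ht_mem : t ∈ Ico 0 T := ⟨ht.le, htT⟩
  -- (1) the azimuthal-average datum in physical coordinates
  obtain ⟨v₀, hv₀s, hv₀div, hv₀ax, -, hv₀close⟩ :=
    exists_smooth_axisym_azimuthalAverage_close_ball u t (hns.contDiff_velocity ht_mem) (hns.divFree t ht_mem)
      x₀ L V K Q W hL hV hW hbd hclose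
  -- (2) its frame form
  set g : EuclideanSpace ℝ (Fin 3) → EuclideanSpace ℝ (Fin 3) := fun Y => Q.symm (v₀ (x₀ + Q Y)) with hg_def
  have hg : ContDiff ℝ ∞ g := Q.symm.contDiff.comp (hv₀s.comp (contDiff_const.add Q.contDiff))
  have hgdiv : VectorCalculus.IsDivFree g := by
    have h1 : VectorCalculus.IsDivFree fun y => v₀ (y + x₀) := isDivFree_comp_add hv₀div x₀
    have h2 := h1.conj_linearIsometryEquiv (R := Q.symm)
    refine fun y => ?_
    have := h2 y
    simpa [hg_def, add_comm] using this
  have hgax : IsAxisymmetric g := hv₀ax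
  -- (3)–(4) cut off, launch by strong AX, shift, rotate, translate
  obtain ⟨v, q, Mv, hv, hvax, hvbd, hvt⟩ :=
    exists_axisym_flow_of_frame_datum hAXs hg hgdiv hgax hKL hν htT x₀ Q
  refine ⟨v, q, Mv, hv, hvax, hvbd, fun x hx => ?_⟩
  have hY : ‖Q.symm (x - x₀)‖ < K * L := by
    rw [LinearIsometryEquiv.norm_map, ← dist_eq_norm]; exact mem_ball.1 hx
  rw [hvt x hY]
  have e : Q (g (Q.symm (x - x₀))) = v₀ x := by
    show Q (Q.symm (v₀ (x₀ + Q (Q.symm (x - x₀))))) = v₀ x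
    rw [LinearIsometryEquiv.apply_symm_apply, LinearIsometryEquiv.apply_symm_apply, add_sub_cancel]
  rw [e]
  exact hv₀close x hx

end AxisymComparisonFlow

end Summit.NavierStokesRegularity.NavierStokesRegularity.Theorems

end
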